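import Summits.AtomisticToContinuum.BoseEinsteinCondensation.Theorems.BECRewardDescentRewardScaleChordStubRewardUpper
import Summits.AtomisticToContinuum.BoseEinsteinCondensation.Theorems.BECRewardDescentRewardScaleChordStubEnergyLower

/-!
# Route `BECRewardDescent`, crux `RewardScaleChord` (stmt-AtomisticToContinuum-12877): the proof

Closes stmt-AtomisticToContinuum-12877 (rank-5 crux, RUNG 1 of the reward walk) by the registered
line `birth` (`Cruxes/RewardScaleChord/Lines/birth.lean`): this file is that skeleton with its two
stubs discharged by the landed `--supports` files

* `Theorems/BECRewardDescentRewardScaleChordStubRewardUpper.lean` —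
  `RewardScaleChord.stub_rewardUpper` (TRIAL-STATE SIDE): for every `η > 0`, at small density,
  eventually in `N`, for every `s ≥ 0`, `R(s) ≤ 4πaρ(1+η)N + sηN` (the reward functional at the
  condensed trial state of `condensedTrialState_proof`);
* `Theorems/BECRewardDescentRewardScaleChordStubEnergyLower.lean` —
  `RewardScaleChord.stub_energyLower` (ENERGY SIDE): for every `ε > 0`, at small density,
  eventually in `N`, `E₀^per(N,(N/ρ)^{1/3}) ≥ 4πaρ(1−ε)N` (thermodynamic-limit form of the proved
  LSSY Thm. 2.4, `LSSY2005_lowerBound_periodic_holds`).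

**The crux.** `RewardScaleChord`: for every repulsive finite-range `v` and all `τ, θ > 0` there is
`ρ₀ > 0` such that for `0 < ρ < ρ₀`, eventually in `N` (torus of side `L = (N/ρ)^{1/3}`), and
every reward `s > 0` with `s ≥ θρa` (`a` the scattering length):
`R(s) := inf_Ψ (⟨Ψ,HΨ⟩ + s·(N − ⟨Ψ,n̂₀Ψ⟩)) ≤ E₀^per(N,L) + sτN`.

**The chord estimate (composition).** With `η = ε := min(1/2, τ/2, θτ/16π)` (`exists_small`), for
`s ≥ θρa`: `R(s) ≤ 4πaρ(1+η)N + sηN = 4πaρ(1−η)N + (8πaρη + sη)N ≤ E₀^per + sτN`, because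
`8πaρη ≤ 8πηs/θ ≤ τs/2` and `sη ≤ τs/2` (`chord_arith`); the `ℝ≥0∞` step is `ENNReal.ofReal_add`
twice and `add_le_add`. Unconditional: every input is proved in the tree (LSSY 2005 Thms. 2.2/2.4,
the Jastrow condensed trial state, finiteness of the scattering length for finite range).

## References

* [LSSY2005] E. H. Lieb, R. Seiringer, J. P. Solovej, J. Yngvason, *The Mathematics of the Bose
  Gas and its Condensation*, Birkhäuser 2005 (arXiv:cond-mat/0610117), Thm. 2.2 (2.14) and
  Thm. 2.4 (2.35).
-/

noncomputable section

open MeasureTheory Filter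
open scoped ENNReal

namespace Summit.AtomisticToContinuum.BoseEinsteinCondensation.Theorems

open Literature.MathematicalPhysics.QuantumManyBody.BoseGas

namespace RewardScaleChord

/-! ### The glue (real arithmetic of the chord estimate) -/

/-- The small parameter of the chord estimate: for `τ, θ > 0` some `η > 0` has `η ≤ 1/2`,
`η ≤ τ/2` and `16πη ≤ θτ` (namely `min(1/2, τ/2, θτ/16π)`). [folklore] -/
theorem exists_small (τ θ : ℝ) (hτ : 0 < τ) (hθ : 0 < θ) :
    ∃ η : ℝ, 0 < η ∧ η ≤ 1 / 2 ∧ η ≤ τ / 2 ∧ η * (16 * Real.pi) ≤ θ * τ := by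
  have hπ : 0 < 16 * Real.pi := by positivity
  refine ⟨min (1 / 2) (min (τ / 2) (θ * τ / (16 * Real.pi))), ?_, min_le_left _ _, ?_, ?_⟩
  · exact lt_min (by norm_num) (lt_min (by positivity) (by positivity))
  · exact (min_le_right _ _).trans (min_le_left _ _)
  · calc min (1 / 2) (min (τ / 2) (θ * τ / (16 * Real.pi))) * (16 * Real.pi)
        ≤ (θ * τ / (16 * Real.pi)) * (16 * Real.pi) :=
          mul_le_mul_of_nonneg_right ((min_le_right _ _).trans (min_le_right _ _)) hπ.le
      _ = θ * τ := div_mul_cancel₀ _ hπ.ne'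

/-- The real-number heart of the chord estimate: for `s ≥ θρa`, `η ≤ τ/2` and `16πη ≤ θτ`,
`8πaρηN + sηN ≤ sτN` (the signs of `a`, `ρ` are not even needed: they enter only through
`θρa ≤ s`). [folklore] -/
theorem chord_arith {a ρ s τ θ η N : ℝ} (hs : 0 ≤ s) (hθ : 0 < θ)
    (hη : 0 ≤ η) (hN : 0 ≤ N) (hη2 : η ≤ τ / 2) (h16 : η * (16 * Real.pi) ≤ θ * τ)
    (hθs : θ * ρ * a ≤ s) :
    8 * Real.pi * a * ρ * η * N + s * η * N ≤ s * τ * N := by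
  have hπ : 0 < Real.pi := Real.pi_pos
  -- 8πaρη ≤ sτ/2, proved after multiplying by θ > 0
  have hst : θ * (8 * Real.pi * a * ρ * η) ≤ θ * (s * τ / 2) := by
    have e1 : θ * (8 * Real.pi * a * ρ * η) = (8 * Real.pi * η) * (θ * ρ * a) := by ring
    have e2 : θ * (s * τ / 2) = (θ * τ) * s / 2 := by ring
    rw [e1, e2]
    have i1 : (8 * Real.pi * η) * (θ * ρ * a) ≤ (8 * Real.pi * η) * s :=
      mul_le_mul_of_nonneg_left hθs (by positivity)
    have i2 : (8 * Real.pi * η) * s ≤ (θ * τ) * s / 2 := by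
      have e3 : (8 * Real.pi * η) * s = (η * (16 * Real.pi)) * s / 2 := by ring
      rw [e3]
      have := mul_le_mul_of_nonneg_right h16 hs
      linarith
    exact i1.trans i2
  have h8 : 8 * Real.pi * a * ρ * η ≤ s * τ / 2 := le_of_mul_le_mul_left hst hθ
  have h9 : s * η ≤ s * (τ / 2) := mul_le_mul_of_nonneg_left hη2 hs
  have h10 : 8 * Real.pi * a * ρ * η * N ≤ s * τ / 2 * N := mul_le_mul_of_nonneg_right h8 hN
  have h11 : s * η * N ≤ s * (τ / 2) * N := mul_le_mul_of_nonneg_right h9 hN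
  have e4 : s * τ / 2 * N + s * (τ / 2) * N = s * τ * N := by ring
  linarith

end RewardScaleChord

/-! ### The item -/

/-- **`RewardScaleChord` holds** (settles stmt-AtomisticToContinuum-12877, exact route decl): for
every repulsive finite-range `v` and `τ, θ > 0` there is `ρ₀ > 0` such that for `0 < ρ < ρ₀`,
eventually in `N`, every reward `s > 0` with `θρa ≤ s` has
`⨅_Ψ (periodicEnergy v Ψ + ofReal s · (N − condensateOccupation Ψ)) ≤ E₀^per(N, (N/ρ)^{1/3}) + ofReal (sτN)`.
Chord estimate: `stub_rewardUpper` and `stub_energyLower` at `η = ε` from `exists_small`, split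
`4πaρ(1+η)N + sηN = 4πaρ(1−η)N + (8πaρηN + sηN)` and `chord_arith`.
[cite: LSSY2005, Thm. 2.2 (2.14) and Thm. 2.4 (2.35)] -/
theorem rewardScaleChord_proof :
    Summit.AtomisticToContinuum.BoseEinsteinCondensation.Theses.BECRewardDescent.RewardScaleChord := by
  unfold Summit.AtomisticToContinuum.BoseEinsteinCondensation.Theses.BECRewardDescent.RewardScaleChord
  intro v hv τ θ hτ hθ
  obtain ⟨η, hη, hη1, hη2, h16⟩ := RewardScaleChord.exists_small τ θ hτ hθ
  obtain ⟨ρ₁, hρ₁, hU⟩ := RewardScaleChord.stub_rewardUpper v hv η hη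
  obtain ⟨ρ₂, hρ₂, hE⟩ := RewardScaleChord.stub_energyLower v hv η hη
  refine ⟨min ρ₁ ρ₂, lt_min hρ₁ hρ₂, fun ρ hρ hρlt => ?_⟩
  have h1 : ρ < ρ₁ := lt_of_lt_of_le hρlt (min_le_left _ _)
  have h2 : ρ < ρ₂ := lt_of_lt_of_le hρlt (min_le_right _ _)
  filter_upwards [hU ρ hρ h1, hE ρ hρ h2] with N hUN hEN
  intro s hs hθs
  dsimp only
  have hu := hUN s hs.le
  set a : ℝ := (Literature.MathematicalPhysics.QuantumManyBody.BoseGas.scatteringLength v).toReal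
    with ha_def
  have ha : 0 ≤ a := ENNReal.toReal_nonneg
  have hN : (0 : ℝ) ≤ N := N.cast_nonneg
  have h4π : (0 : ℝ) ≤ 4 * Real.pi := by positivity
  have h1η : (0 : ℝ) ≤ 1 - η := by linarith
  have h1η' : (0 : ℝ) ≤ 1 + η := by linarith
  -- nonnegativity of the four real summands
  have hP : 0 ≤ 4 * Real.pi * a * ρ * (1 + η) * N :=
    mul_nonneg (mul_nonneg (mul_nonneg (mul_nonneg h4π ha) hρ.le) h1η') hN
  have hQ : 0 ≤ s * η * N := mul_nonneg (mul_nonneg hs.le hη.le) hN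
  have hA : 0 ≤ 4 * Real.pi * a * ρ * (1 - η) * N :=
    mul_nonneg (mul_nonneg (mul_nonneg (mul_nonneg h4π ha) hρ.le) h1η) hN
  have hB : 0 ≤ 8 * Real.pi * a * ρ * η * N + s * η * N := by
    have : 0 ≤ 8 * Real.pi * a * ρ * η * N :=
      mul_nonneg (mul_nonneg (mul_nonneg (mul_nonneg (by positivity) ha) hρ.le) hη.le) hN
    exact add_nonneg this hQ
  have hsplit : 4 * Real.pi * a * ρ * (1 + η) * N + s * η * N
      = 4 * Real.pi * a * ρ * (1 - η) * N + (8 * Real.pi * a * ρ * η * N + s * η * N) := by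
    ring
  have hkey : 8 * Real.pi * a * ρ * η * N + s * η * N ≤ s * τ * N :=
    RewardScaleChord.chord_arith hs.le hθ hη.le hN hη2 h16 hθs
  refine hu.trans ?_
  rw [← ENNReal.ofReal_add hP hQ, hsplit, ENNReal.ofReal_add hA hB]
  exact add_le_add hEN (ENNReal.ofReal_le_ofReal hkey)

end Summit.AtomisticToContinuum.BoseEinsteinCondensation.Theorems

end
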